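import Literature.NumberTheory.LFunctions.Zhang2022.DetectorShiftDoubledParseval
import Literature.NumberTheory.LFunctions.Zhang2022.DetectorCellPointwise
import Literature.NumberTheory.LFunctions.Zhang2022.DetectorTwoSidedCircle
import Literature.NumberTheory.LFunctions.Zhang2022.DetectorShiftLatticeSymbol
import Literature.NumberTheory.LFunctions.Zhang2022.DetectorTwoPointIdentity
import Literature.NumberTheory.LFunctions.Zhang2022.DetectorDoublingCompose
import Literature.NumberTheory.LFunctions.Zhang2022.DetectorShiftDilatedLeadingCoeff
import Mathlib.NumberTheory.ZetaValues
import Literature.NumberTheory.LFunctions.Zhang2022.DetectorShiftPSDSharpTwist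
import Literature.NumberTheory.LFunctions.Zhang2022.DetectorTwoSidedGlued

/-!
# Zhang (2022) detector main-term forms — the one-sided E-010 slot HOLDS at a shift triple OUTSIDE Lemma 2.3's box
# (cell landau-siegel §E, S-E-p5-17; KNIFE-EDGES K11 «slot regions off the box»). Part 1: «one pin kills one negative mode»

Y. Zhang, *Discrete mean estimates and the Landau–Siegel zero*, arXiv:2211.02515v1 (2022) [Zhang2022LandauSiegel] —
an unrefereed manuscript under adjudication. **WHAT THIS IS NOT: a claim about its Theorems 1–2, about Landau–Siegel
zeros, about Parity, or about a repaired `Margin232`. The programme SEARCHES and TYPES; no claim about Landau–Siegel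
zeros, Theorems 1–2 of arXiv:2211.02515 or a repaired Margin232 until a kernel theorem says so.**

Part 1 (this file's first landing) is the abstract coefficient lemma behind the desk criterion of
HOME/barrier/p5/GLUED-SLOT-REGION.md (ls-barrier-p5 g5): a diagonal Hermitian form `Σ_m σ(m)|d_m|²` with `σ(0) = 0`,
exactly ONE negative weight `σ(m₀) < 0` and all other weights positive is `≥ 0` on the hyperplane `Σ_m m·d_m = 0`
as soon as `Σ_{m ≠ 0, m₀} m²/σ(m) ≤ m₀²/|σ(m₀)|` (Cauchy–Schwarz with the optimal weights; stated at `HasSum` level with the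
Schur bound as a bound on all finite partial sums). No detector object enters Part 1.

Part 2 (append): `Det.bulkFormOn_periodic_two_piece_nonneg_of_pin` — the periodic two-piece bulk form of
`Det.bulkFormOn_periodic_two_piece_nonneg_of_ibp` is `≥ 0` WITHOUT sign-admissibility when the right piece is PINNED
(`R′(1) = 0`), the lattice symbol `σ_b` has exactly one negative mode and the pin index has slack (Parseval on the cell +
POINTWISE inversion of the glued first derivative at `y = −1`, `Det.hasSum_dpiece_pointwise`, + Part 1); and the instance
**`Det.formDetPSD_shiftRecipe_offBoxTriple : FormDetPSD (shiftRecipe (1/2, 5/2, 13/4))`** — the one-sided E-010 slot HOLDS at a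
triple that is NOT sign-admissible (`Det.not_signAdmissible_offBoxTriple`; one negative mode `m₀ = −3`, `σ(−3) = −15/16`,
majorant `Det.offBoxMajorant` with `Σ G = (4/3)π² − 1435/144 + 3536/945 ≈ 6.94 ≤ 9.6`; `c₀ > 0` by the width lemma
`Det.re_sum_shiftW_pos_of_widths`), i.e. `Det.exists_formDetPSD_shiftRecipe_not_signAdmissible`: the one-sided slot region is
STRICTLY LARGER than Lemma 2.3's box (the windowed slot region IS the box: `Det.dictShiftPSD_iff_signAdmissible`). Taxonomy of
the main-term form only (KNIFE-EDGES K11; ls-barrier-plan g2 row S-E-p5-17): no coverage row, no word, no displayed premise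
of the class of record depends on it; certified numerics of record for the same point: kit j270198 (lineage A).

Part 3 (append): at the same point the WINDOWED slot FAILS — `Det.not_dictShiftPSD_offBoxTriple` (K8,
`Det.dictShiftPSD_iff_signAdmissible`, with `c₀(b♭) > 0`), packaged with Part 2 as `Det.offBoxTriple_slots` (K11 at one kernel point).

Part 4 (append): the GLUED slot at the same point — `Det.bulkFormOn_periodic_two_piece_nonneg_of_pin_at` (pin at any
`y₀ ∈ [0,1]`), `Det.formDetGlued_nonneg_of_twoPointArc_pin` (the K6″ composition of `DetectorTwoSidedGlued` with sign-admissibility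
replaced by the one-negative-mode hypotheses, pin at the split point) and **`Det.gluedFormPSD_offBoxTriple : GluedFormPSD (1/2, 5/2, 13/4)`**;
`Det.offBoxTriple_three_slots`: at `b♭` the one-sided and glued slots HOLD, the windowed slot FAILS (K11, all three slots).

References: Y. Zhang, arXiv:2211.02515v1 (2022), Prop. 7.1 p.44 with (7.2), §8 (8.11)–(8.23); Y. Katznelson, *An introduction
to harmonic analysis* (2004), Ch. I §5 [Katznelson2004]. [cite: Zhang2022LandauSiegel, Prop 7.1 p.44 with (7.2), (8.11)–(8.23)]
-/

noncomputable section

open Complex Real Set Filter Topology Finset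
open scoped ComplexConjugate
open intervalIntegral
open _root_.MeasureTheory

namespace Literature.NumberTheory.LFunctions.Zhang2022

namespace Det

/-! ### Part 1 — one linear pin kills one negative mode (abstract, `HasSum` level) -/

/-- **Finite Cauchy–Schwarz with the optimal weights**: for positive weights `σ` on a finite set,
`‖Σ_{m∈s} m·d_m‖² ≤ (Σ_{m∈s} m²/σ(m)) · (Σ_{m∈s} σ(m)‖d_m‖²)`. [cite: Katznelson2004, Ch. I §5] -/
theorem norm_sum_int_mul_sq_le {ι : Type*} (s : Finset ι) (n : ι → ℤ) (σ : ι → ℝ) (d : ι → ℂ)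
    (hσ : ∀ i ∈ s, 0 < σ i) :
    ‖∑ i ∈ s, (n i : ℂ) * d i‖ ^ 2 ≤ (∑ i ∈ s, (n i : ℝ) ^ 2 / σ i) * (∑ i ∈ s, σ i * ‖d i‖ ^ 2) := by
  have h1 : ‖∑ i ∈ s, (n i : ℂ) * d i‖ ≤ ∑ i ∈ s, |(n i : ℝ)| / Real.sqrt (σ i) * (Real.sqrt (σ i) * ‖d i‖) := by
    refine (norm_sum_le _ _).trans (le_of_eq (Finset.sum_congr rfl fun i hi => ?_))
    have hs : 0 < Real.sqrt (σ i) := Real.sqrt_pos.2 (hσ i hi)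
    rw [norm_mul, Complex.norm_intCast]
    field_simp
  have h2 := Finset.sum_mul_sq_le_sq_mul_sq s (fun i => |(n i : ℝ)| / Real.sqrt (σ i)) (fun i => Real.sqrt (σ i) * ‖d i‖)
  have h3 : ∑ i ∈ s, (|(n i : ℝ)| / Real.sqrt (σ i)) ^ 2 = ∑ i ∈ s, (n i : ℝ) ^ 2 / σ i :=
    Finset.sum_congr rfl fun i hi => by
      rw [div_pow, sq_abs, Real.sq_sqrt (hσ i hi).le]
  have h4 : ∑ i ∈ s, (Real.sqrt (σ i) * ‖d i‖) ^ 2 = ∑ i ∈ s, σ i * ‖d i‖ ^ 2 :=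
    Finset.sum_congr rfl fun i hi => by
      rw [mul_pow, Real.sq_sqrt (hσ i hi).le]
  have h0 : 0 ≤ ∑ i ∈ s, |(n i : ℝ)| / Real.sqrt (σ i) * (Real.sqrt (σ i) * ‖d i‖) :=
    Finset.sum_nonneg fun i hi => by
      have hs : 0 < Real.sqrt (σ i) := Real.sqrt_pos.2 (hσ i hi)
      positivity
  calc ‖∑ i ∈ s, (n i : ℂ) * d i‖ ^ 2
      ≤ (∑ i ∈ s, |(n i : ℝ)| / Real.sqrt (σ i) * (Real.sqrt (σ i) * ‖d i‖)) ^ 2 :=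
        pow_le_pow_left₀ (norm_nonneg _) h1 2
    _ ≤ (∑ i ∈ s, (|(n i : ℝ)| / Real.sqrt (σ i)) ^ 2) * ∑ i ∈ s, (Real.sqrt (σ i) * ‖d i‖) ^ 2 := h2
    _ = _ := by rw [h3, h4]

/-- **ONE LINEAR PIN KILLS ONE NEGATIVE MODE.** Let `σ : ℤ → ℝ` with `σ 0 = 0`, exactly one negative weight
`σ m₀ < 0` (`m₀ ≠ 0`) and `σ m > 0` for `m ∉ {0, m₀}`; let `d : ℤ → ℂ` with `HasSum (m ↦ σ(m)‖d_m‖²) T` and the PIN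
`HasSum (m ↦ m·d_m) 0`. If every finite partial sum of `Σ_{m≠0,m₀} m²/σ(m)` is `≤ R₀` and `R₀·|σ(m₀)| ≤ m₀²` (the Schur
condition «pin index ≤ 0» with slack), then `0 ≤ T`. [cite: Katznelson2004, Ch. I §5] -/
theorem pin_kills_one_negative_mode {σ : ℤ → ℝ} {d : ℤ → ℂ} {T R₀ : ℝ} {m₀ : ℤ} (hm₀ : m₀ ≠ 0) (hσ0 : σ 0 = 0)
    (hneg : σ m₀ < 0) (hpos : ∀ m : ℤ, m ≠ 0 → m ≠ m₀ → 0 < σ m)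
    (hT : HasSum (fun m : ℤ => σ m * ‖d m‖ ^ 2) T) (hpin : HasSum (fun m : ℤ => (m : ℂ) * d m) 0)
    (hR : ∀ s : Finset ℤ, (∀ m ∈ s, m ≠ 0 ∧ m ≠ m₀) → ∑ m ∈ s, (m : ℝ) ^ 2 / σ m ≤ R₀)
    (hslack : R₀ * |σ m₀| ≤ (m₀ : ℝ) ^ 2) : 0 ≤ T := by
  classical
  set s₀ : Finset ℤ := {0, m₀} with hs₀
  have hpair : ∀ f : ℤ → ℂ, ∑ m ∈ s₀, f m = f 0 + f m₀ := fun f => Finset.sum_pair (Ne.symm hm₀)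
  have hpairR : ∀ f : ℤ → ℝ, ∑ m ∈ s₀, f m = f 0 + f m₀ := fun f => Finset.sum_pair (Ne.symm hm₀)
  have hmem : ∀ m : {m // m ∉ s₀}, (m : ℤ) ≠ 0 ∧ (m : ℤ) ≠ m₀ := by
    intro m
    have h := m.2
    simp only [hs₀, Finset.mem_insert, Finset.mem_singleton, not_or] at h
    exact h
  -- the positive part `P = Σ_{m ∉ s₀} σ(m)‖d_m‖²`
  set P : ℝ := T - σ m₀ * ‖d m₀‖ ^ 2 with hP
  have hTC : HasSum (fun m : {m // m ∉ s₀} => σ m * ‖d (m : ℤ)‖ ^ 2) P := by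
    refine (Finset.hasSum_compl_iff (f := fun m : ℤ => σ m * ‖d m‖ ^ 2) s₀).2 ?_
    rw [hpairR, hσ0, zero_mul, zero_add, hP, sub_add_cancel]
    exact hT
  have hPnonneg : 0 ≤ P :=
    HasSum.nonneg (fun m : {m // m ∉ s₀} => mul_nonneg (hpos m (hmem m).1 (hmem m).2).le (sq_nonneg _)) hTC
  -- the pin on the complement: `Σ_{m ∉ s₀} m·d_m = −m₀·d_{m₀}`
  have hpinC : HasSum (fun m : {m // m ∉ s₀} => ((m : ℤ) : ℂ) * d (m : ℤ)) (-((m₀ : ℂ) * d m₀)) := by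
    refine (Finset.hasSum_compl_iff (f := fun m : ℤ => (m : ℂ) * d m) s₀).2 ?_
    rw [hpair]
    simp only [Int.cast_zero, zero_mul, zero_add, neg_add_cancel]
    exact hpin
  -- `R₀ ≥ 0`
  have hR0 : 0 ≤ R₀ := by simpa using hR ∅ (by simp)
  -- every finite partial sum of the complement pin is bounded by `√(R₀ P)`
  have hbound : ∀ u : Finset {m // m ∉ s₀},
      ‖∑ i ∈ u, ((i : ℤ) : ℂ) * d (i : ℤ)‖ ≤ Real.sqrt (R₀ * P) := by
    intro u
    have hcs := norm_sum_int_mul_sq_le u (fun i => (i : ℤ)) (fun i => σ i) (fun i => d (i : ℤ))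
      (fun i _ => hpos i (hmem i).1 (hmem i).2)
    have hA : ∑ i ∈ u, (((i : ℤ) : ℤ) : ℝ) ^ 2 / σ (i : ℤ) ≤ R₀ := by
      have := hR (u.map (Function.Embedding.subtype _)) fun m hm => by
        obtain ⟨i, _, rfl⟩ := Finset.mem_map.1 hm
        exact hmem i
      rw [Finset.sum_map] at this
      exact this
    have hB : ∑ i ∈ u, σ (i : ℤ) * ‖d (i : ℤ)‖ ^ 2 ≤ P :=
      sum_le_hasSum u (fun i _ => mul_nonneg (hpos i (hmem i).1 (hmem i).2).le (sq_nonneg _)) hTC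
    have hA0 : 0 ≤ ∑ i ∈ u, (((i : ℤ) : ℤ) : ℝ) ^ 2 / σ (i : ℤ) :=
      Finset.sum_nonneg fun i _ => div_nonneg (sq_nonneg _) (hpos i (hmem i).1 (hmem i).2).le
    have hsq : ‖∑ i ∈ u, ((i : ℤ) : ℂ) * d (i : ℤ)‖ ^ 2 ≤ R₀ * P :=
      hcs.trans (mul_le_mul hA hB (Finset.sum_nonneg fun i _ =>
        mul_nonneg (hpos i (hmem i).1 (hmem i).2).le (sq_nonneg _)) hR0)
    exact (Real.le_sqrt (norm_nonneg _) (mul_nonneg hR0 hPnonneg)).2 hsq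
  -- pass to the limit along the `HasSum` filter
  have hlim : ‖-((m₀ : ℂ) * d m₀)‖ ≤ Real.sqrt (R₀ * P) :=
    le_of_tendsto' (Filter.Tendsto.norm hpinC) hbound
  have hkey : (m₀ : ℝ) ^ 2 * ‖d m₀‖ ^ 2 ≤ R₀ * P := by
    have h1 : ‖-((m₀ : ℂ) * d m₀)‖ = |(m₀ : ℝ)| * ‖d m₀‖ := by
      rw [norm_neg, norm_mul, Complex.norm_intCast]
    rw [h1] at hlim
    have h2 : (|(m₀ : ℝ)| * ‖d m₀‖) ^ 2 ≤ R₀ * P := by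
      have := pow_le_pow_left₀ (by positivity) hlim 2
      rwa [Real.sq_sqrt (mul_nonneg hR0 hPnonneg)] at this
    rwa [mul_pow, sq_abs] at h2
  -- conclude: `T = P + σ(m₀)‖d_{m₀}‖² ≥ P − |σ(m₀)|·R₀·P/m₀² ≥ 0`
  have hσabs : σ m₀ = -|σ m₀| := by rw [abs_of_neg hneg, neg_neg]
  have hm₀sq : 0 < (m₀ : ℝ) ^ 2 := by positivity
  have hstep : |σ m₀| * ((m₀ : ℝ) ^ 2 * ‖d m₀‖ ^ 2) ≤ (m₀ : ℝ) ^ 2 * P := by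
    calc |σ m₀| * ((m₀ : ℝ) ^ 2 * ‖d m₀‖ ^ 2) ≤ |σ m₀| * (R₀ * P) :=
          mul_le_mul_of_nonneg_left hkey (abs_nonneg _)
      _ = R₀ * |σ m₀| * P := by ring
      _ ≤ (m₀ : ℝ) ^ 2 * P := mul_le_mul_of_nonneg_right hslack hPnonneg
  have hT' : T = P + σ m₀ * ‖d m₀‖ ^ 2 := by rw [hP]; ring
  rw [hT', hσabs]
  nlinarith [hstep, hm₀sq, hPnonneg, abs_nonneg (σ m₀), sq_nonneg ‖d m₀‖]

/-! ### Part 2 — the periodic two-piece form with ONE PIN, and the off-box instance `b = (1/2, 5/2, 13/4)` -/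

section Pinned

variable {b : Fin 3 → ℝ} {L L' L'' R R' R'' : ℝ → ℂ}

/-- Continuity of a glued function on the cell from continuity of the pieces and matching at `0`. [folklore] -/
private theorem continuousOn_glue_cell₂ (hLc : ContinuousOn L (Icc (-1:ℝ) 0)) (hRc : ContinuousOn R (Icc (0:ℝ) 1))
    (hm : L 0 = R 0) : ContinuousOn (glue L R) (Icc (-1:ℝ) 1) := by
  unfold glue
  refine ContinuousOn.piecewise ?_ ?_ ?_
  · rintro a ⟨-, ha⟩
    rw [frontier_Iic, mem_singleton_iff] at ha
    rw [ha]; exact hm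
  · rw [closure_Iic]
    exact hLc.mono fun y hy => ⟨hy.1.1, hy.2⟩
  · rw [compl_Iic, closure_Ioi]
    exact hRc.mono fun y hy => ⟨hy.2, hy.1.2⟩

/-- Right-derivatives of a glued function at the interior points of the left piece. [folklore] -/
private theorem hasDerivWithinAt_glue_left₂ {f f' g g' : ℝ → ℂ} {y : ℝ} (hy : y < 0)
    (h : HasDerivWithinAt f (f' y) (Ioi y) y) : HasDerivWithinAt (glue f g) (glue f' g' y) (Ioi y) y := by
  rw [glue_of_le hy.le]
  refine h.congr_of_eventuallyEq ?_ (glue_of_le hy.le)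
  exact Filter.eventuallyEq_of_mem (Ioo_mem_nhdsGT hy) fun z hz => glue_of_le hz.2.le

/-- Right-derivatives of a glued function at the interior points of the right piece. [folklore] -/
private theorem hasDerivWithinAt_glue_right₂ {f f' g g' : ℝ → ℂ} {y : ℝ} (hy : 0 < y)
    (h : HasDerivWithinAt g (g' y) (Ioi y) y) : HasDerivWithinAt (glue f g) (glue f' g' y) (Ioi y) y := by
  rw [glue_of_pos hy]
  refine h.congr_of_eventuallyEq ?_ (glue_of_pos hy)
  exact Filter.eventuallyEq_of_mem self_mem_nhdsWithin fun z hz => glue_of_pos (hy.trans hz)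

/-- The transform of a glued function over the left half is that of the left piece. [folklore] -/
private theorem dpiece_glue_left₂ (f g : ℝ → ℂ) (m : ℤ) : dpiece (-1) 0 (glue f g) m = dpiece (-1) 0 f m := by
  unfold dpiece
  refine intervalIntegral.integral_congr fun y hy => ?_
  rw [Set.uIcc_of_le (by norm_num)] at hy
  simp only [glue_of_le hy.2]

/-- The transform of a glued function over the right half is that of the right piece. [folklore] -/
private theorem dpiece_glue_right₂ (f g : ℝ → ℂ) (m : ℤ) : dpiece 0 1 (glue f g) m = dpiece 0 1 g m := by
  unfold dpiece
  refine intervalIntegral.integral_congr_ae (ae_of_all _ fun y hy => ?_)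
  rw [Set.uIoc_of_le zero_le_one] at hy
  simp only [glue_of_pos hy.1]

/-- `σ_b(0) = 0`: the constant mode carries no bulk energy. [cite: Zhang2022LandauSiegel, Prop 7.1 (8.11)–(8.23)] -/
theorem latticeSymbol_zero (b : Fin 3 → ℝ) : latticeSymbol b 0 = 0 := by simp [latticeSymbol]

/-- **THE PERIODIC TWO-PIECE BULK FORM WITH ONE PIN IS `≥ 0` OFF THE BOX** (K11, positive side). Pieces `L` on
`[−1,0]`, `R` on `[0,1]` as in `Det.bulkFormOn_periodic_two_piece_nonneg_of_ibp` (continuous with continuous first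
derivative, right-derivatives, `L″, R″ ∈ L²`, `C¹` matching at `0` and periodically, the right piece's second rule by an
IBP identity) and the PIN `R′(1) = 0`. If the lattice symbol `σ_b` has exactly one negative mode `m₀ ≠ 0`, is positive at
every other `m ≠ 0`, and `m²/σ_b(m) ≤ G(m)` off `{0, m₀}` for a non-negative `G` with `HasSum G R₀` and `R₀·|σ_b(m₀)| ≤ m₀²`
(pin index `≤ 0` with slack), then `0 ≤ T_b^{[−1,0]}(L) + T_b^{[0,1]}(R)` — NO sign-admissibility of `b` assumed.
Proof: Parseval on the cell (`hasSum_bulkFormOn_cell_of_rules`), pointwise inversion of the glued first derivative at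
`y = −1` (`hasSum_dpiece_pointwise`, value `L′(−1) = R′(1) = 0`) and `pin_kills_one_negative_mode`.
[cite: Zhang2022LandauSiegel, Prop 7.1 p.44 with (7.2), (8.11)–(8.23)] -/
theorem bulkFormOn_periodic_two_piece_nonneg_of_pin {m₀ : ℤ} {G : ℤ → ℝ} {R₀ : ℝ} (hm₀ : m₀ ≠ 0)
    (hneg : latticeSymbol b m₀ < 0) (hpos : ∀ m : ℤ, m ≠ 0 → m ≠ m₀ → 0 < latticeSymbol b m)
    (hG : ∀ m : ℤ, m ≠ 0 → m ≠ m₀ → (m : ℝ) ^ 2 / latticeSymbol b m ≤ G m) (hG0 : ∀ m, 0 ≤ G m)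
    (hGsum : HasSum G R₀) (hslack : R₀ * |latticeSymbol b m₀| ≤ (m₀ : ℝ) ^ 2)
    (hLc : ContinuousOn L (Icc (-1:ℝ) 0)) (hL'c : ContinuousOn L' (Icc (-1:ℝ) 0))
    (hL''m : MemLp L'' 2 (volume.restrict (Ioc (-1:ℝ) 0)))
    (hLd : ∀ y ∈ Ioo (-1:ℝ) 0, HasDerivWithinAt L (L' y) (Ioi y) y)
    (hL'd : ∀ y ∈ Ioo (-1:ℝ) 0, HasDerivWithinAt L' (L'' y) (Ioi y) y)
    (hRc : ContinuousOn R (Icc (0:ℝ) 1)) (hR'c : ContinuousOn R' (Icc (0:ℝ) 1))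
    (hR''m : MemLp R'' 2 (volume.restrict (Ioc (0:ℝ) 1)))
    (hRd : ∀ y ∈ Ioo (0:ℝ) 1, HasDerivWithinAt R (R' y) (Ioi y) y)
    (hRibp : ∀ m : ℤ, dpiece 0 1 R'' m
      = R' 1 * cexp (-(I * π * m * ((1:ℝ) : ℂ))) - R' 0 * cexp (-(I * π * m * ((0:ℝ) : ℂ)))
        + I * π * m * dpiece 0 1 R' m)
    (hm0 : L 0 = R 0) (hm1 : L' 0 = R' 0) (hp0 : L (-1) = R 1) (hp1 : L' (-1) = R' 1) (hpin : R' 1 = 0) :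
    0 ≤ bulkFormOn b (-1) 0 L L' L'' + bulkFormOn b 0 1 R R' R'' := by
  classical
  have hFc : ContinuousOn (glue L R) (Icc (-1:ℝ) 1) := continuousOn_glue_cell₂ hLc hRc hm0
  have hF'c : ContinuousOn (glue L' R') (Icc (-1:ℝ) 1) := continuousOn_glue_cell₂ hL'c hR'c hm1
  have hF''m : MemLp (glue L'' R'') 2 (volume.restrict (Ioc (-1:ℝ) 1)) := memLp_glue hL''m hR''m
  have hFd : ∀ y ∈ Ioo (-1:ℝ) 1, y ∉ ({0} : Finset ℝ) →
      HasDerivWithinAt (glue L R) (glue L' R' y) (Ioi y) y := by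
    intro y hy hyN
    have hy0 : y ≠ 0 := fun h => hyN (by simp [h])
    rcases lt_or_gt_of_ne hy0 with h | h
    · exact hasDerivWithinAt_glue_left₂ h (hLd y ⟨hy.1, h⟩)
    · exact hasDerivWithinAt_glue_right₂ h (hRd y ⟨h, hy.2⟩)
  have hper0 : glue L R (-1) = glue L R 1 := by
    rw [glue_of_le (by norm_num), glue_of_pos one_pos, hp0]
  have hper1 : glue L' R' (-1) = glue L' R' 1 := by
    rw [glue_of_le (by norm_num), glue_of_pos one_pos, hp1]
  -- integrability of the glued derivative data on the two halves
  have hL'i : IntervalIntegrable L' volume (-1) 0 := hL'c.intervalIntegrable_of_Icc (by norm_num)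
  have hR'i : IntervalIntegrable R' volume 0 1 := hR'c.intervalIntegrable_of_Icc zero_le_one
  have hL''i : IntervalIntegrable L'' volume (-1) 0 := intervalIntegrable_of_memLp_Ioc (by norm_num) hL''m
  have hR''i : IntervalIntegrable R'' volume 0 1 := intervalIntegrable_of_memLp_Ioc zero_le_one hR''m
  have gl : ∀ {f g : ℝ → ℂ}, IntervalIntegrable f volume (-1) 0 → IntervalIntegrable g volume 0 1 →
      IntervalIntegrable (glue f g) volume (-1) 0 ∧ IntervalIntegrable (glue f g) volume 0 1 := by
    intro f g hf hg
    have h := (integral_glue hf hg).1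
    refine ⟨h.mono_set ?_, h.mono_set ?_⟩
    · rw [Set.uIcc_of_le (by norm_num), Set.uIcc_of_le (by norm_num)]
      exact Icc_subset_Icc_right zero_le_one
    · rw [Set.uIcc_of_le zero_le_one, Set.uIcc_of_le (by norm_num)]
      exact Icc_subset_Icc_left (by norm_num)
  -- rule 1 on the cell
  have hd1 : ∀ m : ℤ, dpiece (-1) 1 (glue L' R') m = I * π * m * dpiece (-1) 1 (glue L R) m := by
    have h := dcell_deriv (-1) ({0} : Finset ℝ) (S := glue L R) (S' := glue L' R')
    simp only [show (-1:ℝ) + 2 = 1 by norm_num] at h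
    exact h hFc hFd ((gl hL'i hR'i).1.trans (gl hL'i hR'i).2) hper0
  -- rule 2 on the cell
  have hd2 : ∀ m : ℤ, dpiece (-1) 1 (glue L'' R'') m = I * π * m * dpiece (-1) 1 (glue L' R') m := by
    intro m
    rw [dpiece_add_adjacent (gl hL''i hR''i).1 (gl hL''i hR''i).2, dpiece_add_adjacent (gl hL'i hR'i).1 (gl hL'i hR'i).2,
      dpiece_glue_left₂, dpiece_glue_right₂, dpiece_glue_left₂, dpiece_glue_right₂,
      dpiece_deriv (by norm_num : (-1:ℝ) ≤ 0) hL'c hL'd hL''i m, hRibp m, hm1, hp1]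
    have hk := dker_one_eq_dker_neg_one m
    push_cast at hk ⊢
    rw [hk]
    ring
  -- Parseval on the cell `[−1, 1]`
  have hsum : HasSum (fun m : ℤ => π ^ 4 / 2 *
      (((m : ℝ) ^ 4 + (b 0 + b 1 + b 2) * (m : ℝ) ^ 3 + (b 0 * b 1 + b 1 * b 2 + b 2 * b 0) * (m : ℝ) ^ 2
        + (b 0 * b 1 * b 2) * (m : ℝ)) * ‖dpiece (-1) 1 (glue L R) m‖ ^ 2))
      (bulkFormOn b (-1) 1 (glue L R) (glue L' R') (glue L'' R'')) := by
    have h := hasSum_bulkFormOn_cell_of_rules b (-1) (S := glue L R) (S' := glue L' R') (S'' := glue L'' R'')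
    simp only [show (-1:ℝ) + 2 = 1 by norm_num] at h
    exact h hFc hF'c hF''m hd1 hd2
  -- the pin on the Fourier side: pointwise inversion of the glued first derivative at `y = −1`
  have hsumm : Summable fun m : ℤ => ‖dpiece (-1) 1 (glue L' R') m‖ := by
    have h := summable_norm_dpiece_of_rule (-1) (S := glue L' R') (S' := glue L'' R'')
    simp only [show (-1:ℝ) + 2 = 1 by norm_num] at h
    exact h hF''m hd2
  have hpt : HasSum (fun m : ℤ => (1 / 2 : ℂ) * dpiece (-1) 1 (glue L' R') m * cexp (I * π * m * ((-1:ℝ) : ℂ)))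
      0 := by
    have h := hasSum_dpiece_pointwise (c := -1) (S := glue L' R') (y := -1)
    simp only [show (-1:ℝ) + 2 = 1 by norm_num] at h
    have h' := h hF'c hper1 hsumm ⟨le_rfl, by norm_num⟩
    rwa [glue_of_le (by norm_num), hp1, hpin] at h'
  -- the phased coefficients `d_m = D(m)·e^{−iπm}`
  set D : ℤ → ℂ := fun m => dpiece (-1) 1 (glue L R) m with hD
  set d : ℤ → ℂ := fun m => D m * cexp (I * π * m * ((-1:ℝ) : ℂ)) with hd
  have hphase : ∀ m : ℤ, ‖cexp (I * π * m * ((-1:ℝ) : ℂ))‖ = 1 := by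
    intro m
    rw [Complex.norm_exp]
    simp
  have hnd : ∀ m : ℤ, ‖d m‖ = ‖D m‖ := by
    intro m; rw [hd]; simp only [norm_mul, hphase m, mul_one]
  have hIπ : (I * π : ℂ) ≠ 0 := mul_ne_zero Complex.I_ne_zero (by exact_mod_cast Real.pi_ne_zero)
  have hpinC : HasSum (fun m : ℤ => (m : ℂ) * d m) 0 := by
    have h := hpt.mul_left (2 / (I * π))
    rw [mul_zero] at h
    refine h.congr_fun fun m => ?_
    rw [hd1 m]
    simp only [hd, hD]
    field_simp
  -- the real coefficient series
  have hσsum : HasSum (fun m : ℤ => latticeSymbol b m * ‖d m‖ ^ 2)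
      (2 / π ^ 4 * bulkFormOn b (-1) 1 (glue L R) (glue L' R') (glue L'' R'')) := by
    have h := hsum.mul_left (2 / π ^ 4)
    refine h.congr_fun fun m => ?_
    have hπ4 : (π : ℝ) ^ 4 ≠ 0 := by positivity
    rw [hnd m]
    simp only [hD]
    rw [latticeSymbol_eq]
    field_simp
  -- finite partial sums of the pin index are bounded by `R₀`
  have hR : ∀ s : Finset ℤ, (∀ m ∈ s, m ≠ 0 ∧ m ≠ m₀) → ∑ m ∈ s, (m : ℝ) ^ 2 / latticeSymbol b m ≤ R₀ := by
    intro s hs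
    calc ∑ m ∈ s, (m : ℝ) ^ 2 / latticeSymbol b m ≤ ∑ m ∈ s, G m :=
          Finset.sum_le_sum fun m hm => hG m (hs m hm).1 (hs m hm).2
      _ ≤ R₀ := sum_le_hasSum s (fun m _ => hG0 m) hGsum
  have key := pin_kills_one_negative_mode (T := 2 / π ^ 4 * bulkFormOn b (-1) 1 (glue L R) (glue L' R') (glue L'' R''))
    hm₀ (latticeSymbol_zero b) hneg hpos hσsum hpinC hR hslack
  have hπ4 : 0 < 2 / (π : ℝ) ^ 4 := by positivity
  have hcell : 0 ≤ bulkFormOn b (-1) 1 (glue L R) (glue L' R') (glue L'' R'') :=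
    (mul_nonneg_iff_of_pos_left hπ4).1 key
  -- split at `0` and read off the pieces
  rw [bulkFormOn_add_adjacent b (x := 0) ⟨by norm_num, by norm_num⟩ hFc hF'c hF''m] at hcell
  have hleft : bulkFormOn b (-1) 0 (glue L R) (glue L' R') (glue L'' R'') = bulkFormOn b (-1) 0 L L' L'' := by
    unfold bulkFormOn
    refine intervalIntegral.integral_congr fun y hy => ?_
    rw [Set.uIcc_of_le (by norm_num)] at hy
    simp only [glue_of_le hy.2]
  have hright : bulkFormOn b 0 1 (glue L R) (glue L' R') (glue L'' R'') = bulkFormOn b 0 1 R R' R'' := by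
    unfold bulkFormOn
    refine intervalIntegral.integral_congr_ae (ae_of_all _ fun y hy => ?_)
    rw [Set.uIoc_of_le zero_le_one] at hy
    simp only [glue_of_pos hy.1]
  rwa [hleft, hright] at hcell

end Pinned

/-! ### The off-box instance `b = (1/2, 5/2, 13/4)`: N = 1 (mode m₀ = −3), pin index `S/π = −52/33 < 0` -/

section OffBox

/-- The named off-box triple `b♭ = (1/2, 5/2, 13/4)`: sorted, `b₀ ≤ 1`, outer gap `b₂ − b₁ = 3/4 ≤ 1`, but the integer `3`
lies strictly inside `(b₁, b₂)` — NOT sign-admissible (`Det.not_signAdmissible_offBoxTriple`).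
[cite: Zhang2022LandauSiegel, §2 Lemma 2.3, (2.13)] -/
def offBoxTriple : Fin 3 → ℝ := ![1 / 2, 5 / 2, 13 / 4]

/-- `b♭₀ = 1/2`. [cite: Zhang2022LandauSiegel, §2 (2.13)] -/
@[simp] theorem offBoxTriple_zero : offBoxTriple 0 = 1 / 2 := rfl

/-- `b♭₁ = 5/2`. [cite: Zhang2022LandauSiegel, §2 (2.13)] -/
@[simp] theorem offBoxTriple_one : offBoxTriple 1 = 5 / 2 := rfl

/-- `b♭₂ = 13/4`. [cite: Zhang2022LandauSiegel, §2 (2.13)] -/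
@[simp] theorem offBoxTriple_two : offBoxTriple 2 = 13 / 4 := rfl

/-- `b♭` is NOT sign-admissible (the integer `3` separates `b₁ = 5/2` from `b₂ = 13/4`). [cite: Zhang2022LandauSiegel, §2 Lemma 2.3] -/
theorem not_signAdmissible_offBoxTriple : ¬ SignAdmissible offBoxTriple := by
  rintro ⟨-, -, -, -, k, hk1, hk2⟩
  simp only [offBoxTriple_one, offBoxTriple_two] at hk1 hk2
  have h3 : (k : ℝ) < 3 := by linarith
  have h4 : (2 : ℝ) < k := by linarith
  have hk3 : k < 3 := by exact_mod_cast h3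
  have hk4 : 2 < k := by exact_mod_cast h4
  omega

/-- The lattice symbol of `b♭` in factored form. [cite: Zhang2022LandauSiegel, Prop 7.1 (8.11)–(8.23)] -/
theorem latticeSymbol_offBoxTriple (m : ℤ) :
    latticeSymbol offBoxTriple m = (m : ℝ) * ((m : ℝ) + 1 / 2) * (((m : ℝ) + 5 / 2) * ((m : ℝ) + 13 / 4)) := by
  simp [latticeSymbol]

/-- `σ_{b♭}(−3) = −15/16 < 0`: the ONE negative mode. [cite: Zhang2022LandauSiegel, Prop 7.1 (8.11)–(8.23)] -/
theorem latticeSymbol_offBoxTriple_neg_three : latticeSymbol offBoxTriple (-3) = -15 / 16 := by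
  rw [latticeSymbol_offBoxTriple]; push_cast; norm_num

/-- Every other non-zero mode of `σ_{b♭}` is positive. [cite: Zhang2022LandauSiegel, Prop 7.1 (8.11)–(8.23)] -/
theorem latticeSymbol_offBoxTriple_pos {m : ℤ} (hm : m ≠ 0) (hm3 : m ≠ -3) : 0 < latticeSymbol offBoxTriple m := by
  rw [latticeSymbol_offBoxTriple]
  rcases lt_trichotomy m 0 with h | h | h
  · -- negative modes: `m = −1, −2` or `m ≤ −4`
    have hcases : m = -1 ∨ m = -2 ∨ m ≤ -4 := by omega
    rcases hcases with rfl | rfl | h4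
    · push_cast; norm_num
    · push_cast; norm_num
    · have hmR : (m : ℝ) ≤ -4 := by exact_mod_cast h4
      have h1 : (m : ℝ) * ((m : ℝ) + 1 / 2) > 0 := by nlinarith
      have h2 : ((m : ℝ) + 5 / 2) * ((m : ℝ) + 13 / 4) > 0 := by nlinarith
      exact mul_pos h1 h2
  · exact absurd h hm
  · have hmR : (1 : ℝ) ≤ m := by exact_mod_cast h
    positivity

/-- The summable majorant of the pin-index terms of `b♭` off `{0, −3}`. [cite: Zhang2022LandauSiegel, Prop 7.1 (8.11)–(8.23)] -/
def offBoxMajorant (m : ℤ) : ℝ :=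
  if 0 < m then 1 / (m : ℝ) ^ 2
  else if m = -1 then 16 / 27 else if m = -2 then 32 / 15 else if m = -4 then 64 / 63
  else if m ≤ -5 then 7 / (m : ℝ) ^ 2 else 0

/-- The majorant is non-negative. [cite: Zhang2022LandauSiegel, Prop 7.1 (8.11)–(8.23)] -/
theorem offBoxMajorant_nonneg (m : ℤ) : 0 ≤ offBoxMajorant m := by
  unfold offBoxMajorant
  split_ifs <;> positivity

/-- Termwise bound `m²/σ_{b♭}(m) ≤ G(m)` off `{0, −3}`. [cite: Zhang2022LandauSiegel, Prop 7.1 (8.11)–(8.23)] -/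
theorem pinTerm_le_offBoxMajorant {m : ℤ} (hm : m ≠ 0) (hm3 : m ≠ -3) :
    (m : ℝ) ^ 2 / latticeSymbol offBoxTriple m ≤ offBoxMajorant m := by
  have hσ := latticeSymbol_offBoxTriple_pos hm hm3
  rw [latticeSymbol_offBoxTriple] at hσ ⊢
  unfold offBoxMajorant
  rcases lt_trichotomy m 0 with h | h | h
  · have hcases : m = -1 ∨ m = -2 ∨ m = -4 ∨ m ≤ -5 := by omega
    rcases hcases with rfl | rfl | rfl | h5
    · simp; norm_num
    · simp; norm_num
    · simp; norm_num
    · have hn0 : ¬ (0 < m) := by omega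
      have hn1 : m ≠ -1 := by omega
      have hn2 : m ≠ -2 := by omega
      have hn4 : m ≠ -4 := by omega
      simp only [hn0, if_false, hn1, hn2, hn4, h5, if_true]
      have hmR : (m : ℝ) ≤ -5 := by exact_mod_cast h5
      have hm2 : 0 < (m : ℝ) ^ 2 := by positivity
      rw [div_le_div_iff₀ hσ hm2]
      -- `m⁴ ≤ 7σ(m)`: substitute `m = −5 − j`, `j ≥ 0`
      set j : ℝ := -5 - (m : ℝ) with hj
      have hj0 : 0 ≤ j := by rw [hj]; linarith
      have hmj : (m : ℝ) = -5 - j := by rw [hj]; ring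
      rw [hmj]
      nlinarith [hj0, sq_nonneg j, mul_nonneg hj0 (sq_nonneg j), pow_nonneg hj0 3, pow_nonneg hj0 4,
        mul_nonneg hj0 (pow_nonneg hj0 3)]
  · exact absurd h hm
  · simp only [h, if_true]
    have hmR : (1 : ℝ) ≤ m := by exact_mod_cast h
    have hm2 : 0 < (m : ℝ) ^ 2 := by positivity
    rw [div_le_div_iff₀ hσ hm2]
    nlinarith [hmR, sq_nonneg (m : ℝ), mul_nonneg (by linarith : (0:ℝ) ≤ m) (sq_nonneg (m : ℝ))]

/-- `Σ G = R♭ := (4/3)π² − 1435/144 + 3536/945` (via Euler's `Σ 1/n² = π²/6`, Mathlib `hasSum_zeta_two`).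
[cite: Zhang2022LandauSiegel, Prop 7.1 (8.11)–(8.23)] -/
theorem hasSum_offBoxMajorant :
    HasSum offBoxMajorant (4 / 3 * π ^ 2 - 1435 / 144 + 3536 / 945) := by
  -- positive modes: `Σ_{n ≥ 0} G(n) = π²/6` (`G(0) = 0 = 1/0²` in Lean's convention)
  have hpos : HasSum (fun n : ℕ => offBoxMajorant n) (π ^ 2 / 6) := by
    refine hasSum_zeta_two.congr_fun fun n => ?_
    unfold offBoxMajorant
    by_cases hn : n = 0
    · subst hn; simp
    · have hn' : (0 : ℤ) < (n : ℤ) := by exact_mod_cast Nat.pos_of_ne_zero hn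
      rw [if_pos hn']
      push_cast
      rfl
  -- negative modes: `G(−(n+1))`; tail `n ≥ 4` is `7/(n+1)²`
  have hzeta5 : HasSum (fun n : ℕ => (1 : ℝ) / ((n + 5 : ℕ) : ℝ) ^ 2) (π ^ 2 / 6 - 205 / 144) := by
    have h := (hasSum_nat_add_iff' (f := fun n : ℕ => (1 : ℝ) / (n : ℝ) ^ 2) 5).2 hasSum_zeta_two
    have hhead : ∑ i ∈ Finset.range 5, (1 : ℝ) / (i : ℝ) ^ 2 = 205 / 144 := by
      simp [Finset.sum_range_succ]
      norm_num
    rw [hhead] at h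
    exact h
  have htail : HasSum (fun n : ℕ => offBoxMajorant (-(((n + 4 : ℕ) : ℤ) + 1))) (7 * (π ^ 2 / 6 - 205 / 144)) := by
    refine (hzeta5.mul_left 7).congr_fun fun n => ?_
    unfold offBoxMajorant
    have h1 : ¬ (0 < -(((n + 4 : ℕ) : ℤ) + 1)) := by omega
    have h2 : (-(((n + 4 : ℕ) : ℤ) + 1)) ≠ -1 := by omega
    have h3 : (-(((n + 4 : ℕ) : ℤ) + 1)) ≠ -2 := by omega
    have h4 : (-(((n + 4 : ℕ) : ℤ) + 1)) ≠ -4 := by omega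
    have h5 : (-(((n + 4 : ℕ) : ℤ) + 1)) ≤ -5 := by omega
    simp only [h1, if_false, h2, h3, h4, h5, if_true]
    push_cast
    ring
  have hneg : HasSum (fun n : ℕ => offBoxMajorant (-((n : ℤ) + 1)))
      (7 * (π ^ 2 / 6 - 205 / 144) + (16 / 27 + 32 / 15 + 0 + 64 / 63)) := by
    have h := (hasSum_nat_add_iff (f := fun n : ℕ => offBoxMajorant (-((n : ℤ) + 1))) 4).1 htail
    have hhead : ∑ i ∈ Finset.range 4, offBoxMajorant (-((i : ℤ) + 1)) = 16 / 27 + 32 / 15 + 0 + 64 / 63 := by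
      simp only [Finset.sum_range_succ, Finset.sum_range_zero, zero_add]
      unfold offBoxMajorant
      norm_num
    rw [hhead] at h
    exact h
  have := HasSum.of_nat_of_neg_add_one hpos hneg
  convert this using 1
  ring

/-- The slack of the pin index at `b♭`: `R♭·|σ_{b♭}(−3)| ≤ 9` (indeed `R♭ ≈ 6.94 < 9.6`; uses `π < 3.15`).
[cite: Zhang2022LandauSiegel, Prop 7.1 (8.11)–(8.23)] -/
theorem offBox_slack : (4 / 3 * π ^ 2 - 1435 / 144 + 3536 / 945) * |latticeSymbol offBoxTriple (-3)| ≤ ((-3 : ℤ) : ℝ) ^ 2 := by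
  rw [latticeSymbol_offBoxTriple_neg_three]
  have hπ := Real.pi_lt_d2
  have hπ0 := Real.pi_pos
  rw [show |(-15 : ℝ) / 16| = 15 / 16 by norm_num]
  push_cast
  nlinarith

/-- `c₀(b♭) > 0` by the WIDTH lemma (`b₀ ≤ 1`, `b₂ − b₁ ≤ 1`; `Det.re_sum_shiftW_pos_of_widths`) — no trigonometric value enters.
[cite: Zhang2022LandauSiegel, proof of Prop 7.1 (7.19)–(7.21)] -/
theorem re_sum_shiftW_offBoxTriple_pos : 0 < (∑ j : Fin 3, shiftW offBoxTriple j).re :=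
  re_sum_shiftW_pos_of_widths (by simp) (by simp; norm_num) (by simp; norm_num) (by simp; norm_num) (by simp; norm_num)

/-- Continuity transported along `y ↦ y + 1`. [folklore] -/
private theorem continuousOn_translate_one₂ {F : ℝ → ℂ} (hF : ContinuousOn F (Icc 0 1)) :
    ContinuousOn (fun y : ℝ => F (y + 1)) (Icc (-1:ℝ) 0) :=
  hF.comp (continuous_id.add continuous_const).continuousOn fun y hy => ⟨by linarith [hy.1], by linarith [hy.2]⟩

/-- Right-derivatives transported along `y ↦ y + 1`. [folklore] -/
private theorem hasDerivWithinAt_translate_one₂ {F F' : ℝ → ℂ}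
    (hd : ∀ y ∈ Ioo (0:ℝ) 1, HasDerivWithinAt F (F' y) (Ioi y) y) {y : ℝ} (hy : y ∈ Ioo (-1:ℝ) 0) :
    HasDerivWithinAt (fun z : ℝ => F (z + 1)) (F' (y + 1)) (Ioi y) y := by
  have hy' : y + 1 ∈ Ioo (0:ℝ) 1 := ⟨by linarith [hy.1], by linarith [hy.2]⟩
  have h := hd (y + 1) hy'
  have h2 : HasDerivWithinAt (fun t : ℝ => t + 1) (1:ℝ) (Ioi y) y := (hasDerivAt_id y).add_const 1 |>.hasDerivWithinAt
  have := h.scomp y h2 (fun t ht => by simpa using ht)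
  rw [Function.comp_def] at this
  simpa using this

/-- **THE ONE-SIDED E-010 SLOT HOLDS OFF LEMMA 2.3's BOX: `Det.FormDetPSD (Det.shiftRecipe (1/2, 5/2, 13/4))`.**
For every one-sided kinked profile `g` with `g(1) = 0`, `0 ≤ 𝔅_{R(b♭)}(g)` although `b♭` is NOT sign-admissible
(`not_signAdmissible_offBoxTriple`): [K1] `(π/2)𝔅 = c₀T^{[0,1]}(S) + F_{b♭}(∫g, −g0)` (`S = tailPrim g`), [K2″] the free-end
form is `c₀T^{[0,1]}(E)` of the exponential two-point extremal with far jets `0`, and the periodic two-piece form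
`E(·+1) ⊕ S` is PINNED at `y = 1` (`S(1) = 0`, `S′(1) = −g(1) = 0`), so `bulkFormOn_periodic_two_piece_nonneg_of_pin`
applies with the single negative mode `m₀ = −3` and the majorant `offBoxMajorant` (`R♭·15/16 ≤ 9`); `c₀(b♭) > 0` by the
width lemma. This is the kernel form of «the one-sided slot region is STRICTLY LARGER than the box» (KNIFE-EDGES K11; the
windowed slot `Det.DictShiftPSD` fails off the box by `Det.dictShiftPSD_iff_signAdmissible`).
[cite: Zhang2022LandauSiegel, §2 Lemma 2.3; Prop 7.1 p.44 with (7.2), (8.11)–(8.23)] -/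
theorem formDetPSD_shiftRecipe_offBoxTriple : FormDetPSD (shiftRecipe offBoxTriple) := by
  intro g g' hg hg1
  set b : Fin 3 → ℝ := offBoxTriple with hb
  have h01 : b 0 ≠ b 1 := by simp [hb]; norm_num
  have h02 : b 0 ≠ b 2 := by simp [hb]; norm_num
  have h12 : b 1 ≠ b 2 := by simp [hb]; norm_num
  have hinj : Function.Injective b := by
    intro i j hij
    fin_cases i <;> fin_cases j <;> first | rfl | (exfalso; simp [hb] at hij; norm_num at hij)
  have hc0 : 0 < (∑ j : Fin 3, shiftW b j).re := re_sum_shiftW_offBoxTriple_pos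
  -- [K1]
  have hK1 := formDet_shiftRecipe_eq_bulk_add_freeEnd hinj hg hg1
  -- [K2″] with zero far jets
  obtain ⟨E, E', E'', hc, hc', hc'', hd, hd', hE0, hE0', hE1, hE1', hid⟩ :=
    twoPoint_pieces b h01 h02 h12 hc0.ne' (∫ y in (0:ℝ)..1, g y) (-g 0) 0 0
  have hF00 : freeEndForm b 0 0 = 0 := by simp [freeEndForm]
  have hglue0 : twoPointGlue b (∫ y in (0:ℝ)..1, g y) (-g 0) 0 0 = 0 := by simp [twoPointGlue]
  rw [hF00, hglue0, add_zero, Complex.zero_re, mul_zero, add_zero] at hid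
  simp only [map_zero, neg_zero] at hE0 hE0'
  -- the right piece `S = tailPrim g`
  obtain ⟨hSc, hS'c, hSd, hS'd, hS''m, hS1, hg1'⟩ := rightPiece_of_kinked hg hg1
  have i'' : IntervalIntegrable (fun y => -g' y) volume 0 1 := intervalIntegrable_of_memLp_Ioc zero_le_one hS''m
  have hRibp : ∀ m : ℤ, dpiece 0 1 (fun y => -g' y) m
      = (fun y => -g y) 1 * cexp (-(I * π * m * ((1:ℝ) : ℂ))) - (fun y => -g y) 0 * cexp (-(I * π * m * ((0:ℝ) : ℂ)))
        + I * π * m * dpiece 0 1 (fun y => -g y) m :=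
    fun m => dpiece_deriv zero_le_one hS'c hS'd i'' m
  -- the pinned periodic two-piece inequality
  have hcell := bulkFormOn_periodic_two_piece_nonneg_of_pin (b := b) (m₀ := -3) (G := offBoxMajorant)
    (R₀ := 4 / 3 * π ^ 2 - 1435 / 144 + 3536 / 945) (by norm_num)
    (by rw [hb, latticeSymbol_offBoxTriple_neg_three]; norm_num)
    (fun m hm hm3 => latticeSymbol_offBoxTriple_pos hm hm3)
    (fun m hm hm3 => pinTerm_le_offBoxMajorant hm hm3) offBoxMajorant_nonneg hasSum_offBoxMajorant
    (by have h := offBox_slack; push_cast at h ⊢; exact h)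
    (L := fun y => E (y + 1)) (L' := fun y => E' (y + 1)) (L'' := fun y => E'' (y + 1))
    (R := tailPrim g) (R' := fun y => -g y) (R'' := fun y => -g' y)
    (continuousOn_translate_one₂ hc) (continuousOn_translate_one₂ hc')
    (memLp_two_of_continuousOn_Icc' (continuousOn_translate_one₂ hc''))
    (fun y hy => hasDerivWithinAt_translate_one₂ hd hy) (fun y hy => hasDerivWithinAt_translate_one₂ hd' hy)
    hSc hS'c hS''m hSd hRibp
    (by simp only [zero_add, hE1, tailPrim_zero])
    (by simp only [zero_add, hE1'])
    (by simp only [neg_add_cancel, hE0, tailPrim_one])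
    (by simp only [neg_add_cancel, hE0', hg1, neg_zero])
    (by simp only [hg1, neg_zero])
  rw [bulkFormOn_comp_add_one] at hcell
  -- assemble
  have key : π / 2 * FormDet (shiftRecipe b) g g'
      = (∑ j : Fin 3, shiftW b j).re * (bulkFormOn b 0 1 E E' E''
          + bulkFormOn b 0 1 (tailPrim g) (fun y => -g y) (fun y => -g' y)) := by
    rw [hK1, ← hid]; ring
  have hπ : 0 < π / 2 := by positivity
  exact (mul_nonneg_iff_of_pos_left hπ).1 (key ▸ mul_nonneg hc0.le hcell)

/-- **The one-sided slot region is STRICTLY LARGER than Lemma 2.3's box** — one kernel witness: `b♭ = (1/2, 5/2, 13/4)`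
carries the E-010 slot and is not sign-admissible. [cite: Zhang2022LandauSiegel, §2 Lemma 2.3; Prop 7.1 p.44 with (7.2)] -/
theorem exists_formDetPSD_shiftRecipe_not_signAdmissible :
    ∃ b : Fin 3 → ℝ, InShiftBox b ∧ ¬ SignAdmissible b ∧ FormDetPSD (shiftRecipe b) :=
  ⟨offBoxTriple, fun j => by fin_cases j <;> simp <;> norm_num, not_signAdmissible_offBoxTriple,
    formDetPSD_shiftRecipe_offBoxTriple⟩

end OffBox

/-! ### Part 3 — K11 at the kernel point `b♭`: one-sided slot HOLDS, windowed slot FAILS (plan G6) -/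

section K11Point

/-- `c₀(b♭) > 0` in atom form (`Det.atomA0 = Σ_j W_j`; plan G6). [cite: Zhang2022LandauSiegel, proof of Prop 7.1 (7.19)–(7.21)] -/
theorem re_atomA0_offBoxTriple_pos : 0 < (atomA0 offBoxTriple).re := re_sum_shiftW_offBoxTriple_pos

/-- **The WINDOWED slot FAILS at `b♭`**: `¬ Det.DictShiftPSD (1/2, 5/2, 13/4)` — K8 (`Det.dictShiftPSD_iff_signAdmissible`,
ls-barrier-num g3) with `c₀(b♭) > 0` and `¬ SignAdmissible b♭`. [cite: Zhang2022LandauSiegel, §2 Lemma 2.3; §4 (4.1); §18 (18.1)] -/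
theorem not_dictShiftPSD_offBoxTriple : ¬ DictShiftPSD offBoxTriple := fun h =>
  not_signAdmissible_offBoxTriple
    ((dictShiftPSD_iff_signAdmissible (b := offBoxTriple) (by simp) (by simp; norm_num) (by simp; norm_num)
      re_sum_shiftW_offBoxTriple_pos).1 h)

/-- **K11 AT ONE KERNEL POINT.** At `b♭ = (1/2, 5/2, 13/4)` — inside the Part-III box, NOT sign-admissible — the ONE-SIDED
E-010 slot `Det.FormDetPSD (Det.shiftRecipe b♭)` HOLDS while the WINDOWED slot `Det.DictShiftPSD b♭` FAILS: the one-sided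
slot region is strictly larger than Lemma 2.3's box, the windowed slot region is the box.
[cite: Zhang2022LandauSiegel, §2 Lemma 2.3; §4 (4.1); Prop 7.1 p.44 with (7.2); §18 (18.1)] -/
theorem offBoxTriple_slots :
    InShiftBox offBoxTriple ∧ ¬ SignAdmissible offBoxTriple ∧
      FormDetPSD (shiftRecipe offBoxTriple) ∧ ¬ DictShiftPSD offBoxTriple :=
  ⟨fun j => by fin_cases j <;> simp <;> norm_num, not_signAdmissible_offBoxTriple,
    formDetPSD_shiftRecipe_offBoxTriple, not_dictShiftPSD_offBoxTriple⟩

end K11Point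

/-! ### Part 4 — the GLUED slot at the same point: pin at an interior point, `Det.GluedFormPSD (1/2, 5/2, 13/4)` -/

section PinnedAt

variable {b : Fin 3 → ℝ} {L L' L'' R R' R'' : ℝ → ℂ}

/-- **The periodic two-piece bulk form with ONE PIN AT ANY POINT `y₀ ∈ [0,1]` of the right piece is `≥ 0` off the box**
(the hypotheses of `bulkFormOn_periodic_two_piece_nonneg_of_pin` with `R′(1) = 0` replaced by `R′(y₀) = 0`): pointwise
inversion of the glued first derivative at `y₀` and the phases `e^{iπmy₀}`; the special case `y₀ = 1` is Part 2's lemma.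
[cite: Zhang2022LandauSiegel, Prop 7.1 p.44 with (7.2), (8.11)–(8.23)] -/
theorem bulkFormOn_periodic_two_piece_nonneg_of_pin_at {m₀ : ℤ} {G : ℤ → ℝ} {R₀ : ℝ} (hm₀ : m₀ ≠ 0)
    (hneg : latticeSymbol b m₀ < 0) (hpos : ∀ m : ℤ, m ≠ 0 → m ≠ m₀ → 0 < latticeSymbol b m)
    (hG : ∀ m : ℤ, m ≠ 0 → m ≠ m₀ → (m : ℝ) ^ 2 / latticeSymbol b m ≤ G m) (hG0 : ∀ m, 0 ≤ G m)
    (hGsum : HasSum G R₀) (hslack : R₀ * |latticeSymbol b m₀| ≤ (m₀ : ℝ) ^ 2)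
    (hLc : ContinuousOn L (Icc (-1:ℝ) 0)) (hL'c : ContinuousOn L' (Icc (-1:ℝ) 0))
    (hL''m : MemLp L'' 2 (volume.restrict (Ioc (-1:ℝ) 0)))
    (hLd : ∀ y ∈ Ioo (-1:ℝ) 0, HasDerivWithinAt L (L' y) (Ioi y) y)
    (hL'd : ∀ y ∈ Ioo (-1:ℝ) 0, HasDerivWithinAt L' (L'' y) (Ioi y) y)
    (hRc : ContinuousOn R (Icc (0:ℝ) 1)) (hR'c : ContinuousOn R' (Icc (0:ℝ) 1))
    (hR''m : MemLp R'' 2 (volume.restrict (Ioc (0:ℝ) 1)))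
    (hRd : ∀ y ∈ Ioo (0:ℝ) 1, HasDerivWithinAt R (R' y) (Ioi y) y)
    (hRibp : ∀ m : ℤ, dpiece 0 1 R'' m
      = R' 1 * cexp (-(I * π * m * ((1:ℝ) : ℂ))) - R' 0 * cexp (-(I * π * m * ((0:ℝ) : ℂ)))
        + I * π * m * dpiece 0 1 R' m)
    (hm0 : L 0 = R 0) (hm1 : L' 0 = R' 0) (hp0 : L (-1) = R 1) (hp1 : L' (-1) = R' 1)
    {y₀ : ℝ} (hy₀ : y₀ ∈ Icc (0:ℝ) 1) (hpin : R' y₀ = 0) :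
    0 ≤ bulkFormOn b (-1) 0 L L' L'' + bulkFormOn b 0 1 R R' R'' := by
  classical
  have hFc : ContinuousOn (glue L R) (Icc (-1:ℝ) 1) := continuousOn_glue_cell₂ hLc hRc hm0
  have hF'c : ContinuousOn (glue L' R') (Icc (-1:ℝ) 1) := continuousOn_glue_cell₂ hL'c hR'c hm1
  have hF''m : MemLp (glue L'' R'') 2 (volume.restrict (Ioc (-1:ℝ) 1)) := memLp_glue hL''m hR''m
  have hFd : ∀ y ∈ Ioo (-1:ℝ) 1, y ∉ ({0} : Finset ℝ) →
      HasDerivWithinAt (glue L R) (glue L' R' y) (Ioi y) y := by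
    intro y hy hyN
    have hy0 : y ≠ 0 := fun h => hyN (by simp [h])
    rcases lt_or_gt_of_ne hy0 with h | h
    · exact hasDerivWithinAt_glue_left₂ h (hLd y ⟨hy.1, h⟩)
    · exact hasDerivWithinAt_glue_right₂ h (hRd y ⟨h, hy.2⟩)
  have hper0 : glue L R (-1) = glue L R 1 := by
    rw [glue_of_le (by norm_num), glue_of_pos one_pos, hp0]
  have hper1 : glue L' R' (-1) = glue L' R' 1 := by
    rw [glue_of_le (by norm_num), glue_of_pos one_pos, hp1]
  have hL'i : IntervalIntegrable L' volume (-1) 0 := hL'c.intervalIntegrable_of_Icc (by norm_num)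
  have hR'i : IntervalIntegrable R' volume 0 1 := hR'c.intervalIntegrable_of_Icc zero_le_one
  have hL''i : IntervalIntegrable L'' volume (-1) 0 := intervalIntegrable_of_memLp_Ioc (by norm_num) hL''m
  have hR''i : IntervalIntegrable R'' volume 0 1 := intervalIntegrable_of_memLp_Ioc zero_le_one hR''m
  have gl : ∀ {f g : ℝ → ℂ}, IntervalIntegrable f volume (-1) 0 → IntervalIntegrable g volume 0 1 →
      IntervalIntegrable (glue f g) volume (-1) 0 ∧ IntervalIntegrable (glue f g) volume 0 1 := by
    intro f g hf hg
    have h := (integral_glue hf hg).1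
    refine ⟨h.mono_set ?_, h.mono_set ?_⟩
    · rw [Set.uIcc_of_le (by norm_num), Set.uIcc_of_le (by norm_num)]
      exact Icc_subset_Icc_right zero_le_one
    · rw [Set.uIcc_of_le zero_le_one, Set.uIcc_of_le (by norm_num)]
      exact Icc_subset_Icc_left (by norm_num)
  have hd1 : ∀ m : ℤ, dpiece (-1) 1 (glue L' R') m = I * π * m * dpiece (-1) 1 (glue L R) m := by
    have h := dcell_deriv (-1) ({0} : Finset ℝ) (S := glue L R) (S' := glue L' R')
    simp only [show (-1:ℝ) + 2 = 1 by norm_num] at h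
    exact h hFc hFd ((gl hL'i hR'i).1.trans (gl hL'i hR'i).2) hper0
  have hd2 : ∀ m : ℤ, dpiece (-1) 1 (glue L'' R'') m = I * π * m * dpiece (-1) 1 (glue L' R') m := by
    intro m
    rw [dpiece_add_adjacent (gl hL''i hR''i).1 (gl hL''i hR''i).2, dpiece_add_adjacent (gl hL'i hR'i).1 (gl hL'i hR'i).2,
      dpiece_glue_left₂, dpiece_glue_right₂, dpiece_glue_left₂, dpiece_glue_right₂,
      dpiece_deriv (by norm_num : (-1:ℝ) ≤ 0) hL'c hL'd hL''i m, hRibp m, hm1, hp1]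
    have hk := dker_one_eq_dker_neg_one m
    push_cast at hk ⊢
    rw [hk]
    ring
  have hsum : HasSum (fun m : ℤ => π ^ 4 / 2 *
      (((m : ℝ) ^ 4 + (b 0 + b 1 + b 2) * (m : ℝ) ^ 3 + (b 0 * b 1 + b 1 * b 2 + b 2 * b 0) * (m : ℝ) ^ 2
        + (b 0 * b 1 * b 2) * (m : ℝ)) * ‖dpiece (-1) 1 (glue L R) m‖ ^ 2))
      (bulkFormOn b (-1) 1 (glue L R) (glue L' R') (glue L'' R'')) := by
    have h := hasSum_bulkFormOn_cell_of_rules b (-1) (S := glue L R) (S' := glue L' R') (S'' := glue L'' R'')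
    simp only [show (-1:ℝ) + 2 = 1 by norm_num] at h
    exact h hFc hF'c hF''m hd1 hd2
  have hsumm : Summable fun m : ℤ => ‖dpiece (-1) 1 (glue L' R') m‖ := by
    have h := summable_norm_dpiece_of_rule (-1) (S := glue L' R') (S' := glue L'' R'')
    simp only [show (-1:ℝ) + 2 = 1 by norm_num] at h
    exact h hF''m hd2
  -- the value of the glued first derivative at the pin point is `R′(y₀) = 0`
  have hval0 : glue L' R' y₀ = 0 := by
    rcases eq_or_lt_of_le hy₀.1 with h | h
    · rw [← h, glue_of_le le_rfl, hm1, h, hpin]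
    · rw [glue_of_pos h, hpin]
  have hpt : HasSum (fun m : ℤ => (1 / 2 : ℂ) * dpiece (-1) 1 (glue L' R') m * cexp (I * π * m * (y₀ : ℂ))) 0 := by
    have h := hasSum_dpiece_pointwise (c := -1) (S := glue L' R') (y := y₀)
    simp only [show (-1:ℝ) + 2 = 1 by norm_num] at h
    have h' := h hF'c hper1 hsumm ⟨by linarith [hy₀.1], hy₀.2⟩
    rwa [hval0] at h'
  set D : ℤ → ℂ := fun m => dpiece (-1) 1 (glue L R) m with hD
  set d : ℤ → ℂ := fun m => D m * cexp (I * π * m * (y₀ : ℂ)) with hd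
  have hphase : ∀ m : ℤ, ‖cexp (I * π * m * (y₀ : ℂ))‖ = 1 := by
    intro m
    rw [Complex.norm_exp]
    simp
  have hnd : ∀ m : ℤ, ‖d m‖ = ‖D m‖ := by
    intro m; rw [hd]; simp only [norm_mul, hphase m, mul_one]
  have hIπ : (I * π : ℂ) ≠ 0 := mul_ne_zero Complex.I_ne_zero (by exact_mod_cast Real.pi_ne_zero)
  have hpinC : HasSum (fun m : ℤ => (m : ℂ) * d m) 0 := by
    have h := hpt.mul_left (2 / (I * π))
    rw [mul_zero] at h
    refine h.congr_fun fun m => ?_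
    rw [hd1 m]
    simp only [hd, hD]
    field_simp
  have hσsum : HasSum (fun m : ℤ => latticeSymbol b m * ‖d m‖ ^ 2)
      (2 / π ^ 4 * bulkFormOn b (-1) 1 (glue L R) (glue L' R') (glue L'' R'')) := by
    have h := hsum.mul_left (2 / π ^ 4)
    refine h.congr_fun fun m => ?_
    have hπ4 : (π : ℝ) ^ 4 ≠ 0 := by positivity
    rw [hnd m]
    simp only [hD]
    rw [latticeSymbol_eq]
    field_simp
  have hR : ∀ s : Finset ℤ, (∀ m ∈ s, m ≠ 0 ∧ m ≠ m₀) → ∑ m ∈ s, (m : ℝ) ^ 2 / latticeSymbol b m ≤ R₀ := by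
    intro s hs
    calc ∑ m ∈ s, (m : ℝ) ^ 2 / latticeSymbol b m ≤ ∑ m ∈ s, G m :=
          Finset.sum_le_sum fun m hm => hG m (hs m hm).1 (hs m hm).2
      _ ≤ R₀ := sum_le_hasSum s (fun m _ => hG0 m) hGsum
  have key := pin_kills_one_negative_mode (T := 2 / π ^ 4 * bulkFormOn b (-1) 1 (glue L R) (glue L' R') (glue L'' R''))
    hm₀ (latticeSymbol_zero b) hneg hpos hσsum hpinC hR hslack
  have hπ4 : 0 < 2 / (π : ℝ) ^ 4 := by positivity
  have hcell : 0 ≤ bulkFormOn b (-1) 1 (glue L R) (glue L' R') (glue L'' R'') :=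
    (mul_nonneg_iff_of_pos_left hπ4).1 key
  rw [bulkFormOn_add_adjacent b (x := 0) ⟨by norm_num, by norm_num⟩ hFc hF'c hF''m] at hcell
  have hleft : bulkFormOn b (-1) 0 (glue L R) (glue L' R') (glue L'' R'') = bulkFormOn b (-1) 0 L L' L'' := by
    unfold bulkFormOn
    refine intervalIntegral.integral_congr fun y hy => ?_
    rw [Set.uIcc_of_le (by norm_num)] at hy
    simp only [glue_of_le hy.2]
  have hright : bulkFormOn b 0 1 (glue L R) (glue L' R') (glue L'' R'') = bulkFormOn b 0 1 R R' R'' := by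
    unfold bulkFormOn
    refine intervalIntegral.integral_congr_ae (ae_of_all _ fun y hy => ?_)
    rw [Set.uIoc_of_le zero_le_one] at hy
    simp only [glue_of_pos hy.1]
  rwa [hleft, hright] at hcell

end PinnedAt

section GluedOffBox

variable {b : Fin 3 → ℝ} {g₁ g₁' g₂ g₂' : ℝ → ℂ}

/-- **The glued two-point composition WITHOUT sign-admissibility** (K6″ of `DetectorTwoSidedGlued`, ls-barrier-p5 g4, with
`SignAdmissible b` replaced by: `b` injective, `c₀(b) > 0`, and the one-negative-mode / pin-index hypotheses on `σ_b`):
for no-overlap glued sides `g₁` on `[0,t₁]`, `g₂` on `[0,t₂]` (`t₁ + t₂ ≤ 1`) and a two-point piece `E` with the matching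
jets and the [K2″] identity, `0 ≤ FormDetGlued b g₁ g₁′ g₂ g₂′` — the circle function `E(·+1) ⊕ (S₁ − conj S₂(1−·))` is PINNED
at the split point `y₀ = t₁` (`g₁(t₁) = 0 = g₂(1−t₁)`), so `bulkFormOn_periodic_two_piece_nonneg_of_pin_at` applies.
[cite: Zhang2022LandauSiegel, Prop 7.1 p.44 with (7.2), (8.11)–(8.23); §8 (8.2); §12 (12.6)–(12.8); §18 (18.1)] -/
theorem formDetGlued_nonneg_of_twoPointArc_pin {m₀ : ℤ} {G : ℤ → ℝ} {R₀ : ℝ} (hm₀ : m₀ ≠ 0)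
    (hneg : latticeSymbol b m₀ < 0) (hpos : ∀ m : ℤ, m ≠ 0 → m ≠ m₀ → 0 < latticeSymbol b m)
    (hG : ∀ m : ℤ, m ≠ 0 → m ≠ m₀ → (m : ℝ) ^ 2 / latticeSymbol b m ≤ G m) (hG0 : ∀ m, 0 ≤ G m)
    (hGsum : HasSum G R₀) (hslack : R₀ * |latticeSymbol b m₀| ≤ (m₀ : ℝ) ^ 2)
    (hinj : Function.Injective b) (hc0 : 0 < (∑ j : Fin 3, shiftW b j).re)
    (hg₁ : Repair.KinkedProfile g₁ g₁') (hg₂ : Repair.KinkedProfile g₂ g₂') {t₁ t₂ : ℝ} (ht₁ : 0 ≤ t₁) (ht₂ : 0 ≤ t₂)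
    (ht : t₁ + t₂ ≤ 1)
    (hz₁ : ∀ y ∈ Icc t₁ 1, g₁ y = 0 ∧ g₁' y = 0) (hz₂ : ∀ y ∈ Icc t₂ 1, g₂ y = 0 ∧ g₂' y = 0)
    {E E' E'' : ℝ → ℂ} (hc : ContinuousOn E (Icc 0 1)) (hc' : ContinuousOn E' (Icc 0 1))
    (hc'' : ContinuousOn E'' (Icc 0 1))
    (hd : ∀ y ∈ Ioo (0:ℝ) 1, HasDerivWithinAt E (E' y) (Ioi y) y)
    (hd' : ∀ y ∈ Ioo (0:ℝ) 1, HasDerivWithinAt E' (E'' y) (Ioi y) y)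
    (hE0 : E 0 = -conj (∫ y in (0:ℝ)..1, g₂ y)) (hE0' : E' 0 = -conj (g₂ 0))
    (hE1 : E 1 = ∫ y in (0:ℝ)..1, g₁ y) (hE1' : E' 1 = -g₁ 0)
    (hid : (∑ j : Fin 3, shiftW b j).re * bulkFormOn b 0 1 E E' E''
      = freeEndForm b (∫ y in (0:ℝ)..1, g₁ y) (-g₁ 0) + freeEndForm b (∫ y in (0:ℝ)..1, g₂ y) (-g₂ 0)
        + π * (F0DetC (shiftGlueW b) (shiftGlue0 b) b (g₁ 0) (∫ y in (0:ℝ)..1, g₁ y) (g₂ 0)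
            (∫ y in (0:ℝ)..1, g₂ y)).re) :
    0 ≤ FormDetGlued b g₁ g₁' g₂ g₂' := by
  have ht₁1 : t₁ ≤ 1 := by linarith
  have ht₂1 : t₂ ≤ 1 := by linarith
  have h1₁ : g₁ 1 = 0 := (hz₁ 1 ⟨ht₁1, le_rfl⟩).1
  have h1₂ : g₂ 1 = 0 := (hz₂ 1 ⟨ht₂1, le_rfl⟩).1
  obtain ⟨hS₁c, hS₁'c, hS₁d, hS₁'d, hS₁''m, -, -⟩ := rightPiece_of_kinked hg₁ h1₁
  obtain ⟨hGc, hG'c, hGd, hG''m⟩ := reflArc_of_kinked₀ hg₂ h1₂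
  have hzS : ∀ y ∈ Icc (0:ℝ) 1, t₁ ≤ y →
      tailPrim g₁ y = 0 ∧ (fun y => -g₁ y) y = 0 ∧ (fun y => -g₁' y) y = 0 := by
    intro y hy hty
    obtain ⟨e0, e1⟩ := hz₁ y ⟨hty, hy.2⟩
    exact ⟨tailPrim_eq_zero_of_support (fun z hz => (hz₁ z hz).1) hy hty, by simp [e0], by simp [e1]⟩
  have hzG : ∀ y ∈ Icc (0:ℝ) 1, y ≤ t₁ →
      (fun y => -conj (tailPrim g₂ (1 - y))) y = 0 ∧ (fun y => conj (-g₂ (1 - y))) y = 0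
        ∧ (fun y => -conj (-g₂' (1 - y))) y = 0 := by
    intro y hy hty
    have hx : 1 - y ∈ Icc (0:ℝ) 1 := ⟨by linarith [hy.2], by linarith [hy.1]⟩
    have htx : t₂ ≤ 1 - y := by linarith
    obtain ⟨e0, e1⟩ := hz₂ (1 - y) ⟨htx, hx.2⟩
    refine ⟨?_, by simp [e0], by simp [e1]⟩
    simp only [tailPrim_eq_zero_of_support (fun z hz => (hz₂ z hz).1) hx htx, map_zero, neg_zero]
  have hA := bulkFormOn_add_of_separated b t₁ hzS hzG hS₁c hS₁'c hS₁''m hGc hG'c hG''m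
  have hrefl := bulkFormOn_reflect_conj b (tailPrim g₂) (fun y => -g₂ y) (fun y => -g₂' y)
  have i₁' : IntervalIntegrable (fun y => -g₁ y) volume 0 1 := hS₁'c.intervalIntegrable_of_Icc zero_le_one
  have i₁'' : IntervalIntegrable (fun y => -g₁' y) volume 0 1 := intervalIntegrable_of_memLp_Ioc zero_le_one hS₁''m
  have iG' : IntervalIntegrable (fun y => conj (-g₂ (1 - y))) volume 0 1 := hG'c.intervalIntegrable_of_Icc zero_le_one
  have iG'' : IntervalIntegrable (fun y => -conj (-g₂' (1 - y))) volume 0 1 :=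
    intervalIntegrable_of_memLp_Ioc zero_le_one hG''m
  have hRibp : ∀ m : ℤ, dpiece 0 1 (fun y => -g₁' y + -conj (-g₂' (1 - y))) m
      = (-g₁ 1 + conj (-g₂ (1 - 1))) * cexp (-(I * π * m * ((1:ℝ) : ℂ)))
        - (-g₁ 0 + conj (-g₂ (1 - 0))) * cexp (-(I * π * m * ((0:ℝ) : ℂ)))
        + I * π * m * dpiece 0 1 (fun y => -g₁ y + conj (-g₂ (1 - y))) m := by
    intro m
    have eA := dpiece_add' i₁'' iG'' m
    have eB := dpiece_add' i₁' iG' m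
    have e1 := dpiece_deriv zero_le_one hS₁'c hS₁'d i₁'' m
    have e2 := reflArc_ibp hg₂ m
    simp only [] at e1 e2
    linear_combination eA + e1 + e2 - I * π * m * eB
  -- the pin at the split point `y₀ = t₁`: `g₁(t₁) = 0` and `g₂(1 − t₁) = 0` (`1 − t₁ ≥ t₂`)
  have hpin : (fun y : ℝ => -g₁ y + conj (-g₂ (1 - y))) t₁ = 0 := by
    have e1 : g₁ t₁ = 0 := (hz₁ t₁ ⟨le_rfl, ht₁1⟩).1
    have e2 : g₂ (1 - t₁) = 0 := (hz₂ (1 - t₁) ⟨by linarith, by linarith⟩).1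
    simp [e1, e2]
  have hcell := bulkFormOn_periodic_two_piece_nonneg_of_pin_at hm₀ hneg hpos hG hG0 hGsum hslack
    (L := fun y => E (y + 1)) (L' := fun y => E' (y + 1)) (L'' := fun y => E'' (y + 1))
    (R := fun y => tailPrim g₁ y + -conj (tailPrim g₂ (1 - y)))
    (R' := fun y => -g₁ y + conj (-g₂ (1 - y)))
    (R'' := fun y => -g₁' y + -conj (-g₂' (1 - y)))
    (continuousOn_translate_one₂ hc) (continuousOn_translate_one₂ hc')
    (memLp_two_of_continuousOn_Icc' (continuousOn_translate_one₂ hc''))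
    (fun y hy => hasDerivWithinAt_translate_one₂ hd hy) (fun y hy => hasDerivWithinAt_translate_one₂ hd' hy)
    (hS₁c.add hGc) (hS₁'c.add hG'c) (hS₁''m.add hG''m)
    (fun y hy => (hS₁d y hy).add (hGd y hy)) hRibp
    (by simp only [zero_add, hE1, sub_zero, tailPrim_one, tailPrim_zero, map_zero, neg_zero, add_zero])
    (by simp only [zero_add, hE1', sub_zero, h1₂, neg_zero, map_zero, add_zero])
    (by simp only [neg_add_cancel, hE0, sub_self, tailPrim_one, tailPrim_zero, zero_add])
    (by simp only [neg_add_cancel, hE0', sub_self, h1₁, neg_zero, map_neg, zero_add])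
    (y₀ := t₁) ⟨ht₁, ht₁1⟩ hpin
  rw [bulkFormOn_comp_add_one, hA, hrefl] at hcell
  have hK1 := formDetGlued_eq_bulk_add hinj hg₁ h1₁ hg₂ h1₂
  rw [← hid] at hK1
  have key : π / 2 * FormDetGlued b g₁ g₁' g₂ g₂'
      = (∑ j : Fin 3, shiftW b j).re * (bulkFormOn b 0 1 E E' E''
          + (bulkFormOn b 0 1 (tailPrim g₁) (fun y => -g₁ y) (fun y => -g₁' y)
            + bulkFormOn b 0 1 (tailPrim g₂) (fun y => -g₂ y) (fun y => -g₂' y))) := by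
    rw [hK1]; ring
  have hπ : 0 < π / 2 := by positivity
  exact (mul_nonneg_iff_of_pos_left hπ).1 (key ▸ mul_nonneg hc0.le hcell)

/-- **THE GLUED SLOT HOLDS AT `b♭` TOO: `Det.GluedFormPSD (1/2, 5/2, 13/4)`** — Family B's no-overlap slot (row 57's slot)
at a triple that is NOT sign-admissible: [K1″] `formDetGlued_eq_bulk_add` + [K2″] `twoPoint_pieces` +
`twoPointGlue_eq_F0DetC` + `formDetGlued_nonneg_of_twoPointArc_pin` with the same one-negative-mode data as the one-sided
instance. At the kernel point `b♭` the one-sided and glued slots HOLD and the windowed slot FAILS (K11).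
[cite: Zhang2022LandauSiegel, Prop 7.1 p.44 with (7.2), (8.11)–(8.23); §12 (12.6)–(12.8); §18 (18.1)] -/
theorem gluedFormPSD_offBoxTriple : GluedFormPSD offBoxTriple := by
  intro u u' v v' h
  obtain ⟨t₁, t₂, ht₁, ht₂, ht, hu, hv⟩ := h.sep
  set b : Fin 3 → ℝ := offBoxTriple with hb
  have h01 : b 0 ≠ b 1 := by simp [hb]; norm_num
  have h02 : b 0 ≠ b 2 := by simp [hb]; norm_num
  have h12 : b 1 ≠ b 2 := by simp [hb]; norm_num
  have hinj : Function.Injective b := by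
    intro i j hij
    fin_cases i <;> fin_cases j <;> first | rfl | (exfalso; simp [hb] at hij; norm_num at hij)
  have hc0 : 0 < (∑ j : Fin 3, shiftW b j).re := re_sum_shiftW_offBoxTriple_pos
  have hb0 : b 0 ≠ 0 := by simp [hb]
  have hb1 : b 1 ≠ 0 := by simp [hb]
  have hb2 : b 2 ≠ 0 := by simp [hb]
  obtain ⟨E, E', E'', hc, hc', hc'', hd, hd', e0, e0', e1, e1', hid⟩ :=
    twoPoint_pieces b h01 h02 h12 hc0.ne' (∫ y in (0:ℝ)..1, u y) (-u 0) (∫ y in (0:ℝ)..1, v y) (-v 0)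
  rw [twoPointGlue_eq_F0DetC hb0 hb1 hb2] at hid
  rw [map_neg] at e0'
  rw [neg_neg, neg_neg] at hid
  exact formDetGlued_nonneg_of_twoPointArc_pin (b := b) (m₀ := -3) (G := offBoxMajorant)
    (R₀ := 4 / 3 * π ^ 2 - 1435 / 144 + 3536 / 945) (by norm_num)
    (by rw [hb, latticeSymbol_offBoxTriple_neg_three]; norm_num)
    (fun m hm hm3 => latticeSymbol_offBoxTriple_pos hm hm3)
    (fun m hm hm3 => pinTerm_le_offBoxMajorant hm hm3) offBoxMajorant_nonneg hasSum_offBoxMajorant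
    (by have h := offBox_slack; push_cast at h ⊢; exact h)
    hinj hc0 h.kinked₁ h.kinked₂ ht₁ ht₂ ht (fun y hy => hu y hy.1) (fun y hy => hv y hy.1)
    hc hc' hc'' hd hd' e0 e0' e1 e1' hid

/-- **K11 at the kernel point, all three slots**: at `b♭ = (1/2, 5/2, 13/4)` (in the Part-III box, NOT sign-admissible)
the ONE-SIDED slot and the no-overlap GLUED slot HOLD, the WINDOWED slot FAILS.
[cite: Zhang2022LandauSiegel, §2 Lemma 2.3; §4 (4.1); Prop 7.1 p.44 with (7.2); §12 (12.6)–(12.8); §18 (18.1)] -/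
theorem offBoxTriple_three_slots :
    ¬ SignAdmissible offBoxTriple ∧ FormDetPSD (shiftRecipe offBoxTriple) ∧ GluedFormPSD offBoxTriple ∧
      ¬ DictShiftPSD offBoxTriple :=
  ⟨not_signAdmissible_offBoxTriple, formDetPSD_shiftRecipe_offBoxTriple, gluedFormPSD_offBoxTriple,
    not_dictShiftPSD_offBoxTriple⟩

end GluedOffBox

end Det

end Literature.NumberTheory.LFunctions.Zhang2022

end
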